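import Summits.QuantumFields.BalabanUV.Beta.GAN24.CapacitanceCancellation
import Summits.QuantumFields.BalabanUV.Beta.GAN24.CapacitanceEndpointBlocks

/-!
# `BalabanUV.Beta.GAN24.CapacitanceCancellationDefect` — binder row G-an2-4 / (CONV-C), road P1-fibre, typer row **P1-Y08cc** (node N10c′),
# PART 2: the DEFECT `|σ·h − 2| ≤ defectConst D·|p|⁴` and the c-c block `|(Cap⁻¹)_cc| ≤ ccConst D·|p|⁸/N^{D+4}` at real momentum

NOT IN PRINT; OUR PROOF ATTEMPT.  HONEST FRAMING (cell contract, verbatim): «discharging `BetaPertH` makes Bałaban's UV stability UNCONDITIONAL — a real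
constructive-QFT result; it is NOT the continuum limit and NOT the Clay problem.»  HONEST DEPENDENCY (verbatim): «continuum YM on T⁴ ⇐ BetaPertH ∧ nine spine
estimates (0/9 proved); BetaPertH ⇐ (D1) ∧ (D4) ∧ CAP+tail; G-an2-4 gates asym, D1 and NE2/3/4.»  [folklore] explicit analysis; no cited fact, no
`def … : Prop`, no wall binder; discharges NOTHING of (CONV-C)'s K-slot by itself.  NOT `BetaPertH`, NOT continuum, NOT Clay.  NOT summit progress.

## What is proved (real `p ∈ [−π, π]^D ∖ {0}`, every `N ≥ 1`, every `D`; `|p|² = momSq p`; leaf-12's currency `capDiag = a_κ`, `capBorder = σ`, `capH = h`,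
## PART 1's `capDiagZero = a⁰_κ`, `capBorderZero = σ⁰`, `capHZero = h⁰`)
* §5 `capH_le_capHZero` (`h ≤ h⁰`), `inv_capDiagZero_sub_inv_capDiag_le`, **`capHZero_sub_capH_le`**: `0 ≤ h⁰ − h ≤ aliasWtConst D·|p|⁸/(2(4/π²)^{2(D+1)}N^{D+4})`;
  **`abs_capBorder_mul_capH_sub_two_le`**: `|σh − 2| ≤ C₂·|p|⁴ + C₃·|p|⁶`, `C₂ = π⁴·aliasWtConst D/(32(4/π²)^{2(D+1)})`, `C₃ = aliasWtConst D·(π²/4)^{D+1}/8`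
  (from PART 1's EXACT `σ⁰h⁰ = 2`: `σh − 2 = −σ⁰(h⁰ − h) + (σ − σ⁰)h`, with `σ⁰ ≤ π⁴N^{D+4}/(16|p|⁴)`, the `|p|²`-carrying border share and leaf-12's `capH_le`);
* §6 on the zone (`|p|² ≤ Dπ²`): the displayed constants `defectConst D = C₂ + C₃·Dπ²`, `ccConst D`, and **`abs_capBorder_mul_capH_sub_two_le'`**:
  `|σh − 2| ≤ defectConst D·|p|⁴`; **`abs_invcc_real_le`**: `|1/(2σ) − 1/(σ²h)| ≤ ccConst D·|p|⁸/N^{D+4}` (the cancellation form `(σh − 2)/(2σ²h)` times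
  leaf-12's `inv_capBorder_le` twice and `inv_capH_le`; `defect_mul_invBounds_le` is the shared arithmetic);
* §7 **`norm_invcc_le`** — THE CONSUMER FORM: for complex data with `a_κ = ↑capDiag`, `σ = ↑capBorder`, `δ_κδ'_κ = ↑(4 sin²(p_κ/2))` (the real-zone
  dictionary of the concrete S1a weights — owed by the assembler (T00 / L08), NOT asserted here), `‖CapacitanceClosedForm.invcc a δ δ' σ‖ ≤ ccConst D·|p|⁸/N^{D+4}`,
  obtained THROUGH leaf-02's `CapacitanceClosedFormGauge.norm_invcc_le_of_defect` (`hSum_eq_capH` identifies the Schur scalar); and its instance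
  **`norm_invcc_fibreAl_le_cancel`** on T00's alias fibre `AliasObjects.fibreAl N (ofRealVec q) h` (leaf-12's dictionary `CapacitanceScalarDictionary.aDiag_fibreAl` /
  `sigma_fibreAl` BY NAME) — the cancellation counterpart of leaf-12's no-cancellation `norm_invcc_fibreAl_le`.
This is `SKELETON-P1.md` A4′(iii) `(Cap⁻¹)_cc ≈ −ε_∥|p|⁶/N^{D+4}`, `ε_∥ = O(p²)` as an `N`-UNIFORM bound with explicit `D`-symbolic constants (ref2 c3); it replaces the
no-cancellation `O(|p|⁴/N^{D+4})` of `CapacitanceClosedForm.norm_invcc_le` (leaf-02 erratum l.2746) and is handed to row P1-L08 `CapacitanceEndpoint` (leaf-20-g7)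
by name.  Unit `b2b-balaban-gan24-formalise-leaf-09` (gen 5), 2026-08-20.
-/

noncomputable section

open Complex Finset
open scoped BigOperators Real

namespace Summit.QuantumFields.BalabanUV.Beta.GAN24.CapacitanceCancellationDefect

open AliasWeights AliasWeightsSum CapacitanceScalarBounds CapacitanceScalarBoundsBorder CapacitanceCancellation
open CapacitanceEndpointBlocks (aliasWtConst_nonneg)
open Literature.MathematicalPhysics.QuantumFieldTheory.King1986 (momSq momSq_nonneg)
open Literature.MathematicalPhysics.QuantumFieldTheory.Balaban1983to89.B4Strip (ofRealVec)
open FibreSymbols (dhat dflat)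

variable {D : ℕ}

/-! ## §5 The Schur-scalar share `h⁰ − h` and the DEFECT `σh − 2` -/

/-- [folklore] `h ≤ h⁰` (each `a⁰_κ ≤ a_κ`). -/
theorem capH_le_capHZero {N : ℕ} [NeZero N] (hN : 1 ≤ N) {p : Fin D → ℝ} (hp : ∀ i, |p i| ≤ π) (hp0 : p ≠ 0) :
    capH N p ≤ capHZero N p := by
  unfold capH capHZero
  exact Finset.sum_le_sum fun κ _ =>
    div_le_div_of_nonneg_left (by positivity) (capDiagZero_pos hN hp hp0 κ) (capDiagZero_le_capDiag N p κ)

/-- [folklore] Uniform bound of the inverse-diagonal share: `1/a⁰_κ − 1/a_κ = (a_κ − a⁰_κ)/(a_κ a⁰_κ) ≤ aliasWtConst D·|p|⁶/(2·(4/π²)^{2(D+1)}·N^{D+4})`. -/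
theorem inv_capDiagZero_sub_inv_capDiag_le {N : ℕ} [NeZero N] (hN : 1 ≤ N) {p : Fin D → ℝ} (hp : ∀ i, |p i| ≤ π)
    (hp0 : p ≠ 0) (κ : Fin D) :
    1 / capDiagZero N p κ - 1 / capDiag N p κ
      ≤ aliasWtConst D * momSq p ^ 3 / (2 * ((4 / π ^ 2) ^ (D + 1)) ^ 2 * (N : ℝ) ^ (D + 4)) := by
  have hN0 : (0 : ℝ) < N := by exact_mod_cast hN
  have hm := momSq_pos hp0
  have ha0 := capDiagZero_pos hN hp hp0 κ
  have ha := capDiag_pos hN hp hp0 κ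
  set Lo := (4 / π ^ 2) ^ (D + 1) * (N : ℝ) ^ (D + 4) / (2 * momSq p) with hLo
  have hLo0 : 0 < Lo := by rw [hLo]; positivity
  have hLa0 : Lo ≤ capDiagZero N p κ := capDiagZero_ge hN hp hp0 κ
  have hLa : Lo ≤ capDiag N p κ := hLa0.trans (capDiagZero_le_capDiag N p κ)
  have hT := capDiag_sub_zero_le_momSq hN hp κ
  have e : 1 / capDiagZero N p κ - 1 / capDiag N p κ
      = (capDiag N p κ - capDiagZero N p κ) / (capDiag N p κ * capDiagZero N p κ) := by
    field_simp
  rw [e]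
  have hprod : Lo * Lo ≤ capDiag N p κ * capDiagZero N p κ := mul_le_mul hLa hLa0 hLo0.le ha.le
  calc (capDiag N p κ - capDiagZero N p κ) / (capDiag N p κ * capDiagZero N p κ)
      ≤ (aliasWtConst D / 8 * momSq p * (N : ℝ) ^ (D + 4)) / (capDiag N p κ * capDiagZero N p κ) :=
        div_le_div_of_nonneg_right hT (by positivity)
    _ ≤ (aliasWtConst D / 8 * momSq p * (N : ℝ) ^ (D + 4)) / (Lo * Lo) := by
        apply div_le_div_of_nonneg_left _ (by positivity) hprod
        have hC : 0 ≤ aliasWtConst D := by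
          unfold aliasWtConst
          have : (1 : ℝ) ≤ (5 : ℝ) ^ D := one_le_pow₀ (by norm_num)
          exact div_nonneg (by linarith) (by norm_num)
        positivity
    _ = aliasWtConst D * momSq p ^ 3 / (2 * ((4 / π ^ 2) ^ (D + 1)) ^ 2 * (N : ℝ) ^ (D + 4)) := by
        rw [hLo]
        have hπ0 : (0 : ℝ) < π := Real.pi_pos
        field_simp
        ring

/-- [folklore] **THE SCHUR-SCALAR SHARE**: `0 ≤ h⁰ − h ≤ aliasWtConst D·|p|⁸/(2·(4/π²)^{2(D+1)}·N^{D+4})` (`Σ_κ 4 sin²(p_κ/2) ≤ |p|²` times the uniform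
bound of `1/a⁰_κ − 1/a_κ`). -/
theorem capHZero_sub_capH_le {N : ℕ} [NeZero N] (hN : 1 ≤ N) {p : Fin D → ℝ} (hp : ∀ i, |p i| ≤ π) (hp0 : p ≠ 0) :
    capHZero N p - capH N p ≤ aliasWtConst D * momSq p ^ 4 / (2 * ((4 / π ^ 2) ^ (D + 1)) ^ 2 * (N : ℝ) ^ (D + 4)) := by
  have hN0 : (0 : ℝ) < N := by exact_mod_cast hN
  have hm := momSq_pos hp0
  set B := aliasWtConst D * momSq p ^ 3 / (2 * ((4 / π ^ 2) ^ (D + 1)) ^ 2 * (N : ℝ) ^ (D + 4)) with hB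
  have hC : 0 ≤ aliasWtConst D := by
    unfold aliasWtConst
    have : (1 : ℝ) ≤ (5 : ℝ) ^ D := one_le_pow₀ (by norm_num)
    exact div_nonneg (by linarith) (by norm_num)
  have hB0 : 0 ≤ B := by rw [hB]; positivity
  have hdiff : capHZero N p - capH N p = ∑ κ, 4 * Real.sin (p κ / 2) ^ 2 * (1 / capDiagZero N p κ - 1 / capDiag N p κ) := by
    unfold capHZero capH
    rw [← Finset.sum_sub_distrib]
    refine Finset.sum_congr rfl fun κ _ => ?_
    ring
  rw [hdiff]
  calc ∑ κ, 4 * Real.sin (p κ / 2) ^ 2 * (1 / capDiagZero N p κ - 1 / capDiag N p κ)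
      ≤ ∑ κ, 4 * Real.sin (p κ / 2) ^ 2 * B :=
        Finset.sum_le_sum fun κ _ =>
          mul_le_mul_of_nonneg_left (inv_capDiagZero_sub_inv_capDiag_le hN hp hp0 κ) (by positivity)
    _ = (∑ κ, 4 * Real.sin (p κ / 2) ^ 2) * B := by rw [Finset.sum_mul]
    _ ≤ momSq p * B := mul_le_mul_of_nonneg_right (four_sin_sq_sum_bounds hp).2 hB0
    _ = aliasWtConst D * momSq p ^ 4 / (2 * ((4 / π ^ 2) ^ (D + 1)) ^ 2 * (N : ℝ) ^ (D + 4)) := by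
        rw [hB]; ring

/-- [folklore] **THE DEFECT BOUND (row (ii))**: `|σ·h − 2| ≤ C₂(D)·|p|⁴ + C₃(D)·|p|⁶` with
`C₂ = π⁴·aliasWtConst D/(32·(4/π²)^{2(D+1)})`, `C₃ = aliasWtConst D·(π²/4)^{D+1}/8` — from `σh − 2 = −σ⁰(h⁰ − h) + (σ − σ⁰)h` (`σ⁰h⁰ = 2`),
`σ⁰ ≤ π⁴N^{D+4}/(16|p|⁴)`, the Schur share above, the `|p|²`-carrying border share and leaf-12's `capH_le`. -/
theorem abs_capBorder_mul_capH_sub_two_le {N : ℕ} [NeZero N] (hN : 1 ≤ N) {p : Fin D → ℝ} (hp : ∀ i, |p i| ≤ π) (hp0 : p ≠ 0) :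
    |capBorder N p * capH N p - 2|
      ≤ π ^ 4 * aliasWtConst D / (32 * ((4 / π ^ 2) ^ (D + 1)) ^ 2) * momSq p ^ 2
        + aliasWtConst D * (π ^ 2 / 4) ^ (D + 1) / 8 * momSq p ^ 3 := by
  have hN0 : (0 : ℝ) < N := by exact_mod_cast hN
  have hm := momSq_pos hp0
  have hπ0 : (0 : ℝ) < π := Real.pi_pos
  have h2 := capBorderZero_mul_capHZero hN hp hp0
  have hs0 := capBorderZero_nonneg N p
  have hs0le := capBorderZero_le hN hp hp0
  have hsh := capBorder_sub_zero_le_momSq hN hp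
  have hsh0 : 0 ≤ capBorder N p - capBorderZero N p := sub_nonneg.2 (capBorderZero_le_capBorder N p)
  have he := capHZero_sub_capH_le hN hp hp0
  have he0 : 0 ≤ capHZero N p - capH N p := sub_nonneg.2 (capH_le_capHZero hN hp hp0)
  have hh := capH_le hN hp hp0
  have hh0 : 0 ≤ capH N p := (capH_pos hN hp hp0).le
  have e : capBorder N p * capH N p - 2
      = -(capBorderZero N p * (capHZero N p - capH N p)) + (capBorder N p - capBorderZero N p) * capH N p := by
    linear_combination h2
  rw [e]
  have hA : capBorderZero N p * (capHZero N p - capH N p)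
      ≤ π ^ 4 * (N : ℝ) ^ (D + 4) / (16 * momSq p ^ 2)
        * (aliasWtConst D * momSq p ^ 4 / (2 * ((4 / π ^ 2) ^ (D + 1)) ^ 2 * (N : ℝ) ^ (D + 4))) :=
    mul_le_mul hs0le he he0 (by positivity)
  have hBd : (capBorder N p - capBorderZero N p) * capH N p
      ≤ aliasWtConst D / 16 * momSq p * (N : ℝ) ^ (D + 4) * (2 * (π ^ 2 / 4) ^ (D + 1) * momSq p ^ 2 / (N : ℝ) ^ (D + 4)) :=
    mul_le_mul hsh hh hh0 (le_trans hsh0 hsh)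
  have hAe : π ^ 4 * (N : ℝ) ^ (D + 4) / (16 * momSq p ^ 2)
        * (aliasWtConst D * momSq p ^ 4 / (2 * ((4 / π ^ 2) ^ (D + 1)) ^ 2 * (N : ℝ) ^ (D + 4)))
      = π ^ 4 * aliasWtConst D / (32 * ((4 / π ^ 2) ^ (D + 1)) ^ 2) * momSq p ^ 2 := by
    field_simp
    ring
  have hBe : aliasWtConst D / 16 * momSq p * (N : ℝ) ^ (D + 4) * (2 * (π ^ 2 / 4) ^ (D + 1) * momSq p ^ 2 / (N : ℝ) ^ (D + 4))
      = aliasWtConst D * (π ^ 2 / 4) ^ (D + 1) / 8 * momSq p ^ 3 := by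
    field_simp
    ring
  calc |-(capBorderZero N p * (capHZero N p - capH N p)) + (capBorder N p - capBorderZero N p) * capH N p|
      ≤ |-(capBorderZero N p * (capHZero N p - capH N p))| + |(capBorder N p - capBorderZero N p) * capH N p| := abs_add_le _ _
    _ = capBorderZero N p * (capHZero N p - capH N p) + (capBorder N p - capBorderZero N p) * capH N p := by
        rw [abs_neg, abs_of_nonneg (mul_nonneg hs0 he0), abs_of_nonneg (mul_nonneg hsh0 hh0)]
    _ ≤ _ := by rw [← hAe, ← hBe]; exact add_le_add hA hBd

/-! ## §6 On the Brillouin zone: one displayed constant.  `|p|² ≤ Dπ²`, `defectConst`, `ccConst` -/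

/-- [folklore] `|p|² ≤ D·π²` on `[−π, π]^D`. -/
theorem momSq_le_of_abs_le {p : Fin D → ℝ} (hp : ∀ i, |p i| ≤ π) : momSq p ≤ D * π ^ 2 := by
  unfold momSq
  calc ∑ i, p i ^ 2 ≤ ∑ _i : Fin D, π ^ 2 := Finset.sum_le_sum fun i _ => by
          rw [← sq_abs]; exact pow_le_pow_left₀ (abs_nonneg _) (hp i) 2
    _ = D * π ^ 2 := by rw [Finset.sum_const, Finset.card_univ, Fintype.card_fin, nsmul_eq_mul]

/-- The DEFECT constant: `|σh − 2| ≤ defectConst D · |p|⁴` on the punctured zone (`C₂ + C₃·Dπ²` of `abs_capBorder_mul_capH_sub_two_le`). -/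
def defectConst (D : ℕ) : ℝ :=
  π ^ 4 * aliasWtConst D / (32 * ((4 / π ^ 2) ^ (D + 1)) ^ 2) + aliasWtConst D * (π ^ 2 / 4) ^ (D + 1) / 8 * (D * π ^ 2)

/-- The c-c constant: `|(Cap⁻¹)_cc| ≤ ccConst D · |p|⁸/N^{D+4}` (defect × `ς²η/2` with leaf-12's `ς`, `η`, and `|p|² ≤ Dπ²`). -/
def ccConst (D : ℕ) : ℝ :=
  defectConst D * (π ^ 2 / 8 + aliasWtConst D * (D * π ^ 2) / 2) / (2 * ((4 / π ^ 2) ^ D) ^ 2 * (4 / π ^ 2))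

/-- [folklore] `0 ≤ defectConst D`. -/
theorem defectConst_nonneg (D : ℕ) : 0 ≤ defectConst D := by
  have := aliasWtConst_nonneg D
  have hπ0 : (0 : ℝ) < π := Real.pi_pos
  unfold defectConst; positivity

/-- [folklore] **DEFECT ON THE ZONE**: `|σ·h − 2| ≤ defectConst D · |p|⁴` for `p ∈ [−π, π]^D ∖ {0}`, every `N ≥ 1`. -/
theorem abs_capBorder_mul_capH_sub_two_le' {N : ℕ} [NeZero N] (hN : 1 ≤ N) {p : Fin D → ℝ} (hp : ∀ i, |p i| ≤ π) (hp0 : p ≠ 0) :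
    |capBorder N p * capH N p - 2| ≤ defectConst D * momSq p ^ 2 := by
  have hm := momSq_pos hp0
  have hA := aliasWtConst_nonneg D
  have hπ0 : (0 : ℝ) < π := Real.pi_pos
  have hzone := momSq_le_of_abs_le hp
  refine (abs_capBorder_mul_capH_sub_two_le hN hp hp0).trans ?_
  unfold defectConst
  rw [add_mul]
  refine add_le_add le_rfl ?_
  calc aliasWtConst D * (π ^ 2 / 4) ^ (D + 1) / 8 * momSq p ^ 3
      = aliasWtConst D * (π ^ 2 / 4) ^ (D + 1) / 8 * momSq p * momSq p ^ 2 := by ring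
    _ ≤ aliasWtConst D * (π ^ 2 / 4) ^ (D + 1) / 8 * (D * π ^ 2) * momSq p ^ 2 := by gcongr

/-- [folklore] THE KEY PRODUCT: with leaf-12's inverse bounds `ς = |p|⁴/((4/π²)^D N^{D+4})` (`inv_capBorder_le`) and
`η = N^{D+4}(π²/(8|p|²) + aliasWtConst D/2)/((4/π²)|p|²)` (`inv_capH_le`): `(defectConst·|p|⁴)·ς²·η/2 ≤ ccConst D·|p|⁸/N^{D+4}`. -/
theorem defect_mul_invBounds_le {N : ℕ} (hN : 1 ≤ N) {p : Fin D → ℝ} (hp : ∀ i, |p i| ≤ π) (hp0 : p ≠ 0) :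
    defectConst D * momSq p ^ 2 * (momSq p ^ 2 / ((4 / π ^ 2) ^ D * (N : ℝ) ^ (D + 4))) ^ 2
        * ((N : ℝ) ^ (D + 4) * (π ^ 2 / (8 * momSq p) + aliasWtConst D / 2) / (4 / π ^ 2 * momSq p)) / 2
      ≤ ccConst D * momSq p ^ 4 / (N : ℝ) ^ (D + 4) := by
  have hN0 : (0 : ℝ) < N := by exact_mod_cast hN
  have hm := momSq_pos hp0
  have hA := aliasWtConst_nonneg D
  have hDc := defectConst_nonneg D
  have hπ0 : (0 : ℝ) < π := Real.pi_pos
  have hzone := momSq_le_of_abs_le hp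
  have e : defectConst D * momSq p ^ 2 * (momSq p ^ 2 / ((4 / π ^ 2) ^ D * (N : ℝ) ^ (D + 4))) ^ 2
        * ((N : ℝ) ^ (D + 4) * (π ^ 2 / (8 * momSq p) + aliasWtConst D / 2) / (4 / π ^ 2 * momSq p)) / 2
      = defectConst D * (π ^ 2 / 8 + aliasWtConst D * momSq p / 2) / (2 * ((4 / π ^ 2) ^ D) ^ 2 * (4 / π ^ 2))
          * momSq p ^ 4 / (N : ℝ) ^ (D + 4) := by
    field_simp
  rw [e]
  unfold ccConst
  have hc : 0 < 2 * ((4 / π ^ 2) ^ D) ^ 2 * (4 / π ^ 2) := by positivity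
  gcongr

/-- [folklore] **THE c-c ENTRY, real currency (row (ii))**: `|1/(2σ) − 1/(σ²h)| = |σh − 2|/(2σ²h) ≤ ccConst D·|p|⁸/N^{D+4}` on the punctured zone,
every `N ≥ 1` — `SKELETON-P1.md` A4′(iii) `(Cap⁻¹)_cc = −ε_∥|p|⁶/N^{D+4}`, `ε_∥ = O(p²)`, with an explicit `D`-symbolic constant. -/
theorem abs_invcc_real_le {N : ℕ} [NeZero N] (hN : 1 ≤ N) {p : Fin D → ℝ} (hp : ∀ i, |p i| ≤ π) (hp0 : p ≠ 0) :
    |1 / (2 * capBorder N p) - 1 / (capBorder N p ^ 2 * capH N p)| ≤ ccConst D * momSq p ^ 4 / (N : ℝ) ^ (D + 4) := by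
  have hσ := capBorder_pos hN hp hp0
  have hh := capH_pos hN hp hp0
  have hd := abs_capBorder_mul_capH_sub_two_le' hN hp hp0
  have hς := inv_capBorder_le hN hp hp0
  have hη := inv_capH_le hN hp hp0
  have hd0 : 0 ≤ defectConst D * momSq p ^ 2 := le_trans (abs_nonneg _) hd
  have hς0 : 0 ≤ (capBorder N p)⁻¹ := inv_nonneg.2 hσ.le
  have e : 1 / (2 * capBorder N p) - 1 / (capBorder N p ^ 2 * capH N p)
      = (capBorder N p * capH N p - 2) * (capBorder N p)⁻¹ * (capBorder N p)⁻¹ * (capH N p)⁻¹ / 2 := by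
    field_simp
  rw [e, abs_div, abs_two, abs_mul, abs_mul, abs_mul, abs_of_nonneg hς0, abs_of_nonneg (inv_nonneg.2 hh.le)]
  set dv := defectConst D * momSq p ^ 2 with hdv
  set ςv := momSq p ^ 2 / ((4 / π ^ 2) ^ D * (N : ℝ) ^ (D + 4)) with hςv
  set ηv := (N : ℝ) ^ (D + 4) * (π ^ 2 / (8 * momSq p) + aliasWtConst D / 2) / (4 / π ^ 2 * momSq p) with hηv
  have s1 : |capBorder N p * capH N p - 2| * (capBorder N p)⁻¹ ≤ dv * ςv := mul_le_mul hd hς hς0 hd0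
  have s1' : 0 ≤ dv * ςv := le_trans (mul_nonneg (abs_nonneg _) hς0) s1
  have s2 : |capBorder N p * capH N p - 2| * (capBorder N p)⁻¹ * (capBorder N p)⁻¹ ≤ dv * ςv * ςv :=
    mul_le_mul s1 hς hς0 s1'
  have s2' : 0 ≤ dv * ςv * ςv := le_trans (mul_nonneg (mul_nonneg (abs_nonneg _) hς0) hς0) s2
  have s3 : |capBorder N p * capH N p - 2| * (capBorder N p)⁻¹ * (capBorder N p)⁻¹ * (capH N p)⁻¹ ≤ dv * ςv * ςv * ηv :=
    mul_le_mul s2 hη (inv_nonneg.2 hh.le) s2'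
  calc |capBorder N p * capH N p - 2| * (capBorder N p)⁻¹ * (capBorder N p)⁻¹ * (capH N p)⁻¹ / 2
      ≤ dv * ςv * ςv * ηv / 2 := div_le_div_of_nonneg_right s3 zero_le_two
    _ = dv * ςv ^ 2 * ηv / 2 := by ring
    _ ≤ ccConst D * momSq p ^ 4 / (N : ℝ) ^ (D + 4) := defect_mul_invBounds_le hN hp hp0

/-! ## §7 The PLUG into leaf-02's complex closed form: `‖invcc a δ δ' σ‖ ≤ ccConst D·|p|⁸/N^{D+4}` under the real-zone dictionary -/

/-- [folklore] Under the dictionary `a_κ = ↑(capDiag N p κ)`, `δ_κδ'_κ = ↑(4 sin²(p_κ/2))` the Schur scalar of `CapacitanceClosedForm` is `↑(capH N p)`. -/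
theorem hSum_eq_capH {N : ℕ} [NeZero N] (p : Fin D → ℝ) (a δ δ' : Fin D → ℂ) (ha : ∀ κ, a κ = (capDiag N p κ : ℂ))
    (hδ : ∀ κ, δ κ * δ' κ = ((4 * Real.sin (p κ / 2) ^ 2 : ℝ) : ℂ)) :
    CapacitanceClosedForm.hSum a δ δ' = (capH N p : ℂ) := by
  unfold CapacitanceClosedForm.hSum capH
  rw [Complex.ofReal_sum]
  exact Finset.sum_congr rfl fun κ _ => by rw [hδ κ, ha κ, Complex.ofReal_div]

/-- [folklore] **THE c-c BLOCK OF THE CAPACITANCE INVERSE (row P1-Y08cc (ii), consumer form)**: for complex data `a, δ, δ', σ` matching leaf-12's real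
alias sums at a real momentum `p ∈ [−π, π]^D ∖ {0}` (`a_κ = capDiag`, `σ = capBorder`, `δ_κδ'_κ = 4 sin²(p_κ/2)` — the dictionary of the concrete S1a weights,
owed by the assembler, NOT asserted here), `‖CapacitanceClosedForm.invcc a δ δ' σ‖ ≤ ccConst D·|p|⁸/N^{D+4}` — via leaf-02's
`CapacitanceClosedFormGauge.norm_invcc_le_of_defect` fed with `abs_capBorder_mul_capH_sub_two_le'`, `inv_capBorder_le`, `inv_capH_le`. -/
theorem norm_invcc_le {N : ℕ} [NeZero N] (hN : 1 ≤ N) {p : Fin D → ℝ} (hp : ∀ i, |p i| ≤ π) (hp0 : p ≠ 0)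
    (a δ δ' : Fin D → ℂ) (σ : ℂ) (ha : ∀ κ, a κ = (capDiag N p κ : ℂ)) (hσ : σ = (capBorder N p : ℂ))
    (hδ : ∀ κ, δ κ * δ' κ = ((4 * Real.sin (p κ / 2) ^ 2 : ℝ) : ℂ)) :
    ‖CapacitanceClosedForm.invcc a δ δ' σ‖ ≤ ccConst D * momSq p ^ 4 / (N : ℝ) ^ (D + 4) := by
  have hσpos := capBorder_pos hN hp hp0
  have hhpos := capH_pos hN hp hp0
  have hS := hSum_eq_capH p a δ δ' ha hδ
  have hσ0 : σ ≠ 0 := by rw [hσ]; exact_mod_cast hσpos.ne'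
  have hh0 : CapacitanceClosedForm.hSum a δ δ' ≠ 0 := by rw [hS]; exact_mod_cast hhpos.ne'
  have hd : ‖σ * CapacitanceClosedForm.hSum a δ δ' - 2‖ ≤ defectConst D * momSq p ^ 2 := by
    rw [hσ, hS, show (2 : ℂ) = ((2 : ℝ) : ℂ) by norm_num, ← Complex.ofReal_mul, ← Complex.ofReal_sub, Complex.norm_real,
      Real.norm_eq_abs]
    exact abs_capBorder_mul_capH_sub_two_le' hN hp hp0
  have hς : ‖σ⁻¹‖ ≤ momSq p ^ 2 / ((4 / π ^ 2) ^ D * (N : ℝ) ^ (D + 4)) := by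
    rw [hσ, ← Complex.ofReal_inv, Complex.norm_real, Real.norm_eq_abs, abs_of_nonneg (inv_nonneg.2 hσpos.le)]
    exact inv_capBorder_le hN hp hp0
  have hη : ‖(CapacitanceClosedForm.hSum a δ δ')⁻¹‖
      ≤ (N : ℝ) ^ (D + 4) * (π ^ 2 / (8 * momSq p) + aliasWtConst D / 2) / (4 / π ^ 2 * momSq p) := by
    rw [hS, ← Complex.ofReal_inv, Complex.norm_real, Real.norm_eq_abs, abs_of_nonneg (inv_nonneg.2 hhpos.le)]
    exact inv_capH_le hN hp hp0
  exact (CapacitanceClosedFormGauge.norm_invcc_le_of_defect a δ δ' hσ0 hh0 hd hς hη).trans (defect_mul_invBounds_le hN hp hp0)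

/-- [folklore] **ON T00's ALIAS FIBRE** (the cancellation counterpart of leaf-12's `CapacitanceScalarDictionary.norm_invcc_fibreAl_le`): at a real momentum
`p = ofRealVec q`, `q ∈ [−π, π]^D ∖ {0}`, the c-c block of the explicit inverse of the closed-form capacitance of `AliasObjects.fibreAl N p h` obeys
`‖invcc (aDiag F) (dhat p) (dflat p) (sigma F)‖ ≤ ccConst D·|q|⁸/N^{D+4}`, every `N ≥ 1` (dictionary `aDiag_fibreAl`, `sigma_fibreAl`,
`SymbolTaylor.dhat_mul_dflat_self_ofRealVec` BY NAME). -/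
theorem norm_invcc_fibreAl_le_cancel {N : ℕ} [NeZero N] (hN : 1 ≤ N) {q : Fin D → ℝ} (hq : ∀ i, |q i| ≤ π) (hq0 : q ≠ 0)
    (h : ∀ m, AliasObjects.LAl N (ofRealVec q) m ≠ 0) :
    ‖CapacitanceClosedForm.invcc (CapacitanceClosedForm.aDiag (AliasObjects.fibreAl N (ofRealVec q) h)) (dhat (ofRealVec q))
        (dflat (ofRealVec q)) (CapacitanceClosedForm.sigma (AliasObjects.fibreAl N (ofRealVec q) h))‖
      ≤ ccConst D * momSq q ^ 4 / (N : ℝ) ^ (D + 4) :=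
  norm_invcc_le hN hq hq0 _ _ _ _ (CapacitanceScalarDictionary.aDiag_fibreAl q h) (CapacitanceScalarDictionary.sigma_fibreAl q h)
    (SymbolTaylor.dhat_mul_dflat_self_ofRealVec q)

end Summit.QuantumFields.BalabanUV.Beta.GAN24.CapacitanceCancellationDefect

end
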